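import Literature.NumberTheory.Automorphic.RankinSelbergHorocycleMellin
import Literature.Analysis.Complex.HolomorphicParametricIntegral
import HarnessLib

/-!
# Rankin–Selberg on `SL₂(ℤ)\ℍ`, II: the entire function `J₀(s) = ∫_𝒟 G · E₀*(·, s) dμ`,
its functional equation, and its identification with `Λ(2s) Γ(s+κ-1) a^{-(s+κ-1)} D(s+κ-1)`

Topic `NumberTheory/Automorphic`; namespace `Literature.NumberTheory.Automorphic`. Proof file
(theorems only; no definition, no named fact), sequel to `RankinSelbergHorocycleMellin`. For a
horocycle datum `(G, C, a, κ, B)` (an `SL₂(ℤ)`-invariant continuous `0 ≤ G ≤ B` on `ℍ` with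
`∫₀¹ G(x+iy) dx = y^κ Σ Cₙ e^{-a n y}`, `Cₙ ≥ 0`, `C₀ = 0`) we integrate `G` over the fundamental
domain `𝒟` against the ENTIRE part `E₀*(z, s) = E*(z, s) + 1/(2s) + 1/(2(1-s))`
(`completedEisenstein₀`, Riemann's continuation of the tree, `ModularEisensteinContinuation`) of the
completed Eisenstein series and PROVE (Rankin 1939, Thm. 3 and §4.4; Selberg 1940; Zagier 1981,
§1, Proposition, "`R(F, s)` … can be continued meromorphically, … functional equation
`R*(F, s) = R*(F, 1 - s)`"):

* `integrableOn_fd_mul_eisensteinE` — `G · E(·, s) ∈ L¹(𝒟)` for `Re s > 1` (lintegral unfolding,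
  `setLIntegral_tsum_smul_eq`);
* `norm_Lambda₀_le_re_add_re`, `Lambda₀_re_eq_of_one_lt`, `norm_completedEisenstein₀_le` — the
  **majorant** `‖E₀*(z, s)‖ ≤ c₁ ‖E(z, 1-σ_a)‖ + c₂ ‖E(z, σ_b)‖ + c₃` on `σ_a ≤ Re s ≤ σ_b`
  (`σ_a < 0`, `σ_b > 1`), from the Mellin representation `Λ₀ = ∫ f_modif t^{s-1}` with
  `f_modif ≥ 0` (Mathlib `WeakFEPair.f_modif`, the tree's `f_modif_thetaFEPair`) and the functional
  equation at real points (the tree's `thetaFEPair_Λ₀_one_sub`);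
* `differentiable_J₀` — **`J₀(s) = ∫_𝒟 G(z) E₀*(z, s) dμ(z)` is entire** (dominated holomorphic
  families, `Literature.Analysis.Complex.differentiableOn_integral_of_dominated`);
* `J₀_one_sub` — **`J₀(1 - s) = J₀(s)`**;
* `J₀_eq_of_one_lt_re` — **for `Re s > 1`,
  `J₀(s) = π^{-s} Γ(s) ζ(2s) · Γ(s+κ-1) a^{-(s+κ-1)} D(s+κ-1) + V/(2s) + V/(2(1-s))`**,
  `V = ∫_𝒟 G dμ` (`completedEisenstein_eq_theta_mul` and the unfolding
  `setIntegral_fd_mul_eisensteinE_eq` of part I);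
* `norm_J₀_le` — the a priori bound `‖J₀(s)‖ ≤ M(σ_a, σ_b)` on closed vertical strips, uniform in
  `Im s`.

## References

* R. A. Rankin, Proc. Cambridge Philos. Soc. 35 (1939), 357–372, Thm. 3, §4.4.
* A. Selberg, Arch. Math. Naturvid. 43 (1940), 47–50.
* D. Zagier, J. Fac. Sci. Univ. Tokyo 28 (1981), 415–437, §1.
-/

noncomputable section

open MeasureTheory Set Filter Real UpperHalfPlane Complex
open scoped Topology MatrixGroups NNReal ENNReal

namespace Literature.NumberTheory.Automorphic

/-! ### `G · E(·, s)` is integrable on `𝒟` for `Re s > 1` -/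

section IntegrableE

variable {G : ℍ → ℝ} {C : ℕ → ℝ} {a B κ : ℝ}

/-- The folded majorant: `Σ_{γ ∈ SL₂(ℤ)} 𝟙_{S'}(γw) (Im γw)^s G(γw) = G(w) · 2E(w, s)` for an
invariant `G` (the coset-to-matrix identity `hasSum_indicator_stripFD_mul`). [folklore] -/
theorem tsum_indicator_cpow_mul_eq (hGinv : ∀ (A : SL(2, ℤ)) (τ : ℍ), G (A • τ) = G τ)
    {s : ℂ} (hs1 : 1 < s.re) (w : ℍ) :
    ∑' γ : (𝒮ℒ : Subgroup (GL (Fin 2) ℝ)),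
      (fun w : ℍ ↦ stripFD.indicator (fun _ ↦ (1 : ℂ)) w * ((w.im : ℝ) : ℂ) ^ s * (G w : ℂ))
        ((γ : GL (Fin 2) ℝ) • w) = (G w : ℂ) * (2 * eisensteinE w s) := by
  have hΨ : ∀ (n : ℤ) (w : ℍ), ((((n : ℝ) +ᵥ w).im : ℝ) : ℂ) ^ s = ((w.im : ℝ) : ℂ) ^ s := by
    intro n w; rw [UpperHalfPlane.vadd_im]
  have hsum : Summable fun v : EisensteinSeries.gammaSet 1 1 0 ↦ ‖(((rowRep v • w).im : ℝ) : ℂ) ^ s‖ := by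
    simp_rw [im_rowRep_cpow_eq_esTerm]
    exact (summable_esTerm hs1 w).norm
  -- invariance of `G` under `𝒮ℒ`
  have hinv : ∀ γ : (𝒮ℒ : Subgroup (GL (Fin 2) ℝ)), G ((γ : GL (Fin 2) ℝ) • w) = G w := by
    rintro ⟨γ, A, rfl⟩
    exact hGinv A w
  have h1 : ∀ γ : (𝒮ℒ : Subgroup (GL (Fin 2) ℝ)),
      (fun w : ℍ ↦ stripFD.indicator (fun _ ↦ (1 : ℂ)) w * ((w.im : ℝ) : ℂ) ^ s * (G w : ℂ))
        ((γ : GL (Fin 2) ℝ) • w) =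
      stripFD.indicator (fun _ ↦ (1 : ℂ)) ((γ : GL (Fin 2) ℝ) • w) *
        ((((γ : GL (Fin 2) ℝ) • w).im : ℝ) : ℂ) ^ s * (G w : ℂ) := by
    intro γ
    show stripFD.indicator (fun _ ↦ (1 : ℂ)) ((γ : GL (Fin 2) ℝ) • w) *
        ((((γ : GL (Fin 2) ℝ) • w).im : ℝ) : ℂ) ^ s * (G ((γ : GL (Fin 2) ℝ) • w) : ℂ) = _
    rw [hinv γ]
  have h2 : ∑' γ : (𝒮ℒ : Subgroup (GL (Fin 2) ℝ)),
      stripFD.indicator (fun _ ↦ (1 : ℂ)) ((γ : GL (Fin 2) ℝ) • w) *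
        ((((γ : GL (Fin 2) ℝ) • w).im : ℝ) : ℂ) ^ s =
      ∑' g : SL(2, ℤ), stripFD.indicator (fun _ ↦ (1 : ℂ)) (g • w) * (((g • w).im : ℝ) : ℂ) ^ s := by
    rw [← slEquivModular.tsum_eq]
    refine tsum_congr fun g ↦ ?_
    rw [slEquivModular_smul]
  have h3 : ∑' g : SL(2, ℤ), stripFD.indicator (fun _ ↦ (1 : ℂ)) (g • w) * (((g • w).im : ℝ) : ℂ) ^ s =
      2 * eisensteinE w s := by
    rw [(hasSum_indicator_stripFD_mul (Ψ := fun w : ℍ ↦ ((w.im : ℝ) : ℂ) ^ s) hΨ w hsum).tsum_eq,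
      tsum_im_rowRep_cpow]
  calc ∑' γ : (𝒮ℒ : Subgroup (GL (Fin 2) ℝ)),
        (fun w : ℍ ↦ stripFD.indicator (fun _ ↦ (1 : ℂ)) w * ((w.im : ℝ) : ℂ) ^ s * (G w : ℂ))
          ((γ : GL (Fin 2) ℝ) • w)
      = ∑' γ : (𝒮ℒ : Subgroup (GL (Fin 2) ℝ)),
          stripFD.indicator (fun _ ↦ (1 : ℂ)) ((γ : GL (Fin 2) ℝ) • w) *
            ((((γ : GL (Fin 2) ℝ) • w).im : ℝ) : ℂ) ^ s * (G w : ℂ) := tsum_congr h1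
    _ = (∑' γ : (𝒮ℒ : Subgroup (GL (Fin 2) ℝ)),
          stripFD.indicator (fun _ ↦ (1 : ℂ)) ((γ : GL (Fin 2) ℝ) • w) *
            ((((γ : GL (Fin 2) ℝ) • w).im : ℝ) : ℂ) ^ s) * (G w : ℂ) := tsum_mul_right
    _ = (2 * eisensteinE w s) * (G w : ℂ) := by rw [h2, h3]
    _ = (G w : ℂ) * (2 * eisensteinE w s) := mul_comm _ _

/-- **`G · E(·, s)` is integrable on `𝒟` for `Re s > 1`** (horocycle datum `G`): its norm is
dominated by the folded sum `Σ_γ |𝟙_{S'} y^s G|(γw)`, whose integral over `𝒟` is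
`2 ‖𝟙_{S'} y^s G‖_{L¹(ℍ)} < ∞` (`setLIntegral_tsum_smul_eq`,
`integrable_indicator_stripFD_cpow_mul`). [folklore] -/
theorem integrableOn_fd_mul_eisensteinE (hGc : Continuous G)
    (hGinv : ∀ (A : SL(2, ℤ)) (τ : ℍ), G (A • τ) = G τ) (hG0 : ∀ τ, 0 ≤ G τ)
    (hGB : ∀ τ, G τ ≤ B) (hC : ∀ n, 0 ≤ C n) (hC0 : C 0 = 0) (ha : 0 < a) (hκ : 0 ≤ κ)
    (hs : ∀ y : ℝ, 0 < y → Summable fun n : ℕ ↦ C n * Real.exp (-a * n * y))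
    (hm : ∀ y : ℝ, 0 < y → ∫ x in (0 : ℝ)..1, G (pt x y) = y ^ κ * ∑' n : ℕ, C n * Real.exp (-a * n * y))
    {s : ℂ} (hs1 : 1 < s.re) :
    IntegrableOn (fun w : ℍ ↦ (G w : ℂ) * eisensteinE w s) ModularGroup.fd := by
  set φ : ℍ → ℂ := fun w ↦ stripFD.indicator (fun _ ↦ (1 : ℂ)) w * ((w.im : ℝ) : ℂ) ^ s * (G w : ℂ)
    with hφ
  have hφi : Integrable φ := integrable_indicator_stripFD_cpow_mul hGc hG0 hGB hC hC0 ha hκ hs hm hs1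
  -- measurability of the product
  have hmeas : AEStronglyMeasurable (fun w : ℍ ↦ (G w : ℂ) * eisensteinE w s)
      (volume.restrict ModularGroup.fd) :=
    ((Complex.continuous_ofReal.comp hGc).mul (continuous_eisensteinE hs1)).aestronglyMeasurable
  refine ⟨hmeas, ?_⟩
  -- the enorm of `G · 2E` is dominated by the folded enorm-sum
  have hdom : ∀ w : ℍ, ‖(G w : ℂ) * eisensteinE w s‖ₑ ≤
      ∑' γ : (𝒮ℒ : Subgroup (GL (Fin 2) ℝ)), ‖φ ((γ : GL (Fin 2) ℝ) • w)‖ₑ := by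
    intro w
    have h := tsum_indicator_cpow_mul_eq (G := G) hGinv hs1 w
    have h2 : ‖(G w : ℂ) * (2 * eisensteinE w s)‖ₑ ≤
        ∑' γ : (𝒮ℒ : Subgroup (GL (Fin 2) ℝ)), ‖φ ((γ : GL (Fin 2) ℝ) • w)‖ₑ := by
      rw [← h]; exact enorm_tsum_le_tsum_enorm
    refine le_trans ?_ h2
    have e2 : ‖(G w : ℂ) * (2 * eisensteinE w s)‖ₑ = ‖(2 : ℂ)‖ₑ * ‖(G w : ℂ) * eisensteinE w s‖ₑ := by
      rw [show (G w : ℂ) * (2 * eisensteinE w s) = 2 * ((G w : ℂ) * eisensteinE w s) by ring, enorm_mul]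
    have h2e : (1 : ℝ≥0∞) ≤ ‖(2 : ℂ)‖ₑ := by
      rw [← ofReal_norm]; norm_num
    rw [e2]
    calc ‖(G w : ℂ) * eisensteinE w s‖ₑ = 1 * ‖(G w : ℂ) * eisensteinE w s‖ₑ := (one_mul _).symm
      _ ≤ ‖(2 : ℂ)‖ₑ * ‖(G w : ℂ) * eisensteinE w s‖ₑ := by gcongr
  have hunf := setLIntegral_tsum_smul_eq modular_le_range_toGL neg_one_mem_modular
    isDiscreteSubgroup_modular.countable isHypFundamentalDomain_modular_fd
    (φ := fun w ↦ ‖φ w‖ₑ) hφi.aestronglyMeasurable.aemeasurable.enorm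
  rw [HasFiniteIntegral]
  calc ∫⁻ w in ModularGroup.fd, ‖(G w : ℂ) * eisensteinE w s‖ₑ
      ≤ ∫⁻ w in ModularGroup.fd, ∑' γ : (𝒮ℒ : Subgroup (GL (Fin 2) ℝ)), ‖φ ((γ : GL (Fin 2) ℝ) • w)‖ₑ :=
        lintegral_mono fun w ↦ hdom w
    _ = 2 * ∫⁻ w, ‖φ w‖ₑ := hunf
    _ < ∞ := ENNReal.mul_lt_top (by norm_num) hφi.hasFiniteIntegral

/-- For real `σ > 1` the Eisenstein series is a non-negative real number:
`‖E(w, σ)‖ = Re E(w, σ)`. [folklore] -/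
theorem norm_eisensteinE_ofReal (w : ℍ) {σ : ℝ} (hσ : 1 < σ) :
    ‖eisensteinE w σ‖ = (eisensteinE w σ).re ∧ 0 ≤ (eisensteinE w σ).re := by
  have hterm : ∀ v : EisensteinSeries.gammaSet 1 1 0, ∃ r : ℝ, 0 ≤ r ∧ esTerm (σ : ℂ) v w = (r : ℂ) := by
    intro v
    refine ⟨(w.im / ‖((v : Fin 2 → ℤ) 0 : ℂ) * w + (v : Fin 2 → ℤ) 1‖ ^ 2) ^ σ,
      Real.rpow_nonneg (div_nonneg w.im_pos.le (sq_nonneg _)) _, ?_⟩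
    rw [esTerm, Complex.ofReal_cpow (div_nonneg w.im_pos.le (sq_nonneg _))]
  choose r hr0 hr using hterm
  have hsum : Summable fun v : EisensteinSeries.gammaSet 1 1 0 ↦ esTerm (σ : ℂ) v w :=
    summable_esTerm (by simpa using hσ) w
  have hE : eisensteinE w σ = (((1 / 2) * ∑' v, r v : ℝ) : ℂ) := by
    rw [eisensteinE]
    simp_rw [hr]
    rw [← Complex.ofReal_tsum]
    push_cast
    ring
  have hnn : 0 ≤ (1 / 2) * ∑' v, r v := mul_nonneg (by norm_num) (tsum_nonneg hr0)
  rw [hE, Complex.norm_real, Complex.ofReal_re, Real.norm_of_nonneg hnn]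
  exact ⟨rfl, hnn⟩

end IntegrableE

/-! ### The majorant of `Λ₀,w(s) = 2 E₀*(w, s)` on vertical strips -/

section Majorant

/-- `f_modif,w(t)` is a non-negative real number for every `t`. [folklore] -/
theorem f_modif_thetaFEPair_ofReal (w : ℍ) (t : ℝ) :
    ∃ r : ℝ, 0 ≤ r ∧ (thetaFEPair w).f_modif t = (r : ℂ) := by
  rw [f_modif_thetaFEPair]
  by_cases h1 : 1 < t
  · refine ⟨thetaQ w t - 1, by linarith [one_le_thetaQ w (one_pos.trans h1)], ?_⟩
    rw [Set.indicator_of_mem (mem_Ioi.mpr h1),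
      Set.indicator_of_notMem (show t ∉ Ioo (0 : ℝ) 1 from fun h ↦ absurd h.2 (not_lt.mpr h1.le))]
    push_cast; ring
  · by_cases h0 : 0 < t ∧ t < 1
    · refine ⟨thetaQ w t - t⁻¹, ?_, ?_⟩
      · rw [thetaQ_eq_inv_mul w h0.1]
        have h1t : 1 ≤ 1 / t := by rw [le_div_iff₀ h0.1]; linarith
        have := one_le_thetaQ w (one_pos.trans_le h1t)
        have ht : 0 < t⁻¹ := inv_pos.mpr h0.1
        nlinarith
      · rw [Set.indicator_of_notMem (show t ∉ Ioi (1 : ℝ) from fun h ↦ h1 h),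
          Set.indicator_of_mem (mem_Ioo.mpr h0)]
        push_cast; ring
    · refine ⟨0, le_rfl, ?_⟩
      rw [Set.indicator_of_notMem (show t ∉ Ioi (1 : ℝ) from fun h ↦ h1 h),
        Set.indicator_of_notMem (show t ∉ Ioo (0 : ℝ) 1 from fun h ↦ h0 h)]
      simp

/-- The Mellin transform of `f_modif,w` converges at every `s`. [folklore] -/
theorem mellinConvergent_f_modif_thetaFEPair (w : ℍ) (s : ℂ) :
    MellinConvergent (thetaFEPair w).f_modif s :=
  ((thetaFEPair w).isStrongFEPair_toStrongFEPair.hasMellin s).1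

/-- **`Λ₀,w(σ)` is real and `≥ 0` at real `σ`**, namely `∫₀^∞ t^{σ-1} f_modif,w(t) dt` with
`f_modif ≥ 0`: `Re Λ₀,w(σ) = ∫₀^∞ t^{σ-1} ‖f_modif,w(t)‖ dt`. [folklore] -/
theorem Lambda₀_re_eq_integral (w : ℍ) (σ : ℝ) :
    ((thetaFEPair w).Λ₀ σ).re = ∫ t in Ioi (0 : ℝ), t ^ (σ - 1) * ‖(thetaFEPair w).f_modif t‖ ∧
      (thetaFEPair w).Λ₀ σ = ((((thetaFEPair w).Λ₀ σ).re : ℝ) : ℂ) := by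
  have he : ∀ t ∈ Ioi (0 : ℝ), (t : ℂ) ^ ((σ : ℂ) - 1) • (thetaFEPair w).f_modif t =
      ((t ^ (σ - 1) * ‖(thetaFEPair w).f_modif t‖ : ℝ) : ℂ) := by
    intro t ht
    obtain ⟨r, hr0, hr⟩ := f_modif_thetaFEPair_ofReal w t
    rw [hr, smul_eq_mul, Complex.norm_real, Real.norm_of_nonneg hr0,
      show (σ : ℂ) - 1 = ((σ - 1 : ℝ) : ℂ) by push_cast; ring, ← Complex.ofReal_cpow (le_of_lt ht)]
    push_cast; ring
  have hΛ : (thetaFEPair w).Λ₀ σ = ((∫ t in Ioi (0 : ℝ), t ^ (σ - 1) * ‖(thetaFEPair w).f_modif t‖ : ℝ) : ℂ) := by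
    rw [WeakFEPair.Λ₀, mellin, setIntegral_congr_fun measurableSet_Ioi he, integral_complex_ofReal]
  refine ⟨by rw [hΛ, Complex.ofReal_re], ?_⟩
  conv_lhs => rw [hΛ]
  rw [hΛ, Complex.ofReal_re]

/-- Integrability of `t ↦ t^{σ-1} ‖f_modif,w(t)‖` on `(0, ∞)` for every real `σ`. [folklore] -/
theorem integrableOn_rpow_mul_norm_f_modif (w : ℍ) (σ : ℝ) :
    IntegrableOn (fun t : ℝ ↦ t ^ (σ - 1) * ‖(thetaFEPair w).f_modif t‖) (Ioi 0) := by
  have h := Integrable.norm (mellinConvergent_f_modif_thetaFEPair w σ)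
  refine IntegrableOn.congr_fun h (fun t ht ↦ ?_) measurableSet_Ioi
  rw [norm_smul, show (σ : ℂ) - 1 = ((σ - 1 : ℝ) : ℂ) by push_cast; ring,
    Complex.norm_cpow_eq_rpow_re_of_pos ht, Complex.ofReal_re]

/-- **The vertical-strip majorant**: for `σ_a ≤ Re s ≤ σ_b`,
`‖Λ₀,w(s)‖ ≤ Re Λ₀,w(σ_a) + Re Λ₀,w(σ_b)` — since `t^{Re s - 1} ≤ t^{σ_a - 1} + t^{σ_b - 1}` on
`(0, ∞)` and `f_modif ≥ 0`. [folklore] -/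
theorem norm_Lambda₀_le_re_add_re (w : ℍ) {σa σb : ℝ} {s : ℂ} (ha : σa ≤ s.re) (hb : s.re ≤ σb) :
    ‖(thetaFEPair w).Λ₀ s‖ ≤ ((thetaFEPair w).Λ₀ σa).re + ((thetaFEPair w).Λ₀ σb).re := by
  rw [(Lambda₀_re_eq_integral w σa).1, (Lambda₀_re_eq_integral w σb).1,
    ← integral_add (integrableOn_rpow_mul_norm_f_modif w σa) (integrableOn_rpow_mul_norm_f_modif w σb),
    WeakFEPair.Λ₀, mellin]
  refine (norm_integral_le_integral_norm _).trans (setIntegral_mono_on ?_ ?_ measurableSet_Ioi fun t ht ↦ ?_)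
  · exact Integrable.norm (mellinConvergent_f_modif_thetaFEPair w s)
  · exact (integrableOn_rpow_mul_norm_f_modif w σa).add (integrableOn_rpow_mul_norm_f_modif w σb)
  · have ht0 : (0 : ℝ) < t := ht
    rw [norm_smul, Complex.norm_cpow_eq_rpow_re_of_pos ht0, Complex.sub_re, Complex.one_re, ← add_mul]
    refine mul_le_mul_of_nonneg_right ?_ (norm_nonneg _)
    rcases le_or_gt 1 t with h1 | h1
    · calc t ^ (s.re - 1) ≤ t ^ (σb - 1) := Real.rpow_le_rpow_of_exponent_le h1 (by linarith)
        _ ≤ t ^ (σa - 1) + t ^ (σb - 1) := le_add_of_nonneg_left (Real.rpow_nonneg ht0.le _)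
    · calc t ^ (s.re - 1) ≤ t ^ (σa - 1) :=
          Real.rpow_le_rpow_of_exponent_ge ht0 h1.le (by linarith)
        _ ≤ t ^ (σa - 1) + t ^ (σb - 1) := le_add_of_nonneg_right (Real.rpow_nonneg ht0.le _)

/-- **`Re Λ₀,w(σ) ≤ 2 ‖π^{-σ} Γ(σ) ζ(2σ)‖ ‖E(w, σ)‖ + 1/σ` for real `σ > 1`**:
`Λ₀ = Λ + 1/s + 1/(1-s)`, `Λ_w = 2E*(w, ·)`, `E*(w, σ) = π^{-σ}Γ(σ)ζ(2σ) E(w, σ)` and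
`1/(1-σ) < 0`. [folklore] -/
theorem Lambda₀_re_le_of_one_lt (w : ℍ) {σ : ℝ} (hσ : 1 < σ) :
    ((thetaFEPair w).Λ₀ σ).re ≤
      2 * ‖(π : ℂ) ^ (-(σ : ℂ)) * Complex.Gamma σ * riemannZeta (2 * σ)‖ * ‖eisensteinE w σ‖ + 1 / σ := by
  have hσ0 : (0 : ℝ) < σ := by linarith
  have hΛ : (thetaFEPair w).Λ σ = 2 * completedEisenstein w σ := by
    rw [completedEisenstein]; ring
  have h1 : (thetaFEPair w).Λ₀ σ = 2 * completedEisenstein w σ + 1 / (σ : ℂ) + 1 / (1 - (σ : ℂ)) := by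
    rw [WeakFEPair.Λ₀_eq, hΛ]
    simp [thetaFEPair]
  have hE := completedEisenstein_eq_theta_mul w (s := σ) (by simpa using hσ)
  rw [h1, hE]
  have hre1 : (1 / (σ : ℂ)).re = 1 / σ := by
    rw [← Complex.ofReal_one, ← Complex.ofReal_div, Complex.ofReal_re]
  have hre2 : (1 / (1 - (σ : ℂ))).re = 1 / (1 - σ) := by
    rw [← Complex.ofReal_one, ← Complex.ofReal_sub, ← Complex.ofReal_div, Complex.ofReal_re]
  rw [Complex.add_re, Complex.add_re, hre1, hre2]
  have hneg : 1 / (1 - σ) ≤ 0 := div_nonpos_of_nonneg_of_nonpos zero_le_one (by linarith)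
  have hle : (2 * ((π : ℂ) ^ (-(σ : ℂ)) * Complex.Gamma σ * riemannZeta (2 * σ) * eisensteinE w σ)).re ≤
      2 * ‖(π : ℂ) ^ (-(σ : ℂ)) * Complex.Gamma σ * riemannZeta (2 * σ)‖ * ‖eisensteinE w σ‖ := by
    refine (Complex.re_le_norm _).trans (le_of_eq ?_)
    rw [norm_mul, norm_mul, Complex.norm_two]
    ring
  linarith

/-- **The majorant of `E₀*(w, s)` on a vertical strip** `σ_a ≤ Re s ≤ σ_b` with `σ_a < 0`,
`σ_b > 1`: `‖E₀*(w, s)‖ ≤ c₁ ‖E(w, 1-σ_a)‖ + c₂ ‖E(w, σ_b)‖ + c₃` with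
`c(σ') = ‖π^{-σ'}Γ(σ')ζ(2σ')‖`, `c₃ = (1/(1-σ_a) + 1/σ_b)/2`. [folklore] -/
theorem norm_completedEisenstein₀_le (w : ℍ) {σa σb : ℝ} (hσa : σa < 0) (hσb : 1 < σb) {s : ℂ}
    (ha : σa ≤ s.re) (hb : s.re ≤ σb) :
    ‖completedEisenstein₀ w s‖ ≤
      ‖(π : ℂ) ^ (-((1 - σa : ℝ) : ℂ)) * Complex.Gamma (1 - σa : ℝ) * riemannZeta (2 * (1 - σa : ℝ))‖ *
          ‖eisensteinE w (1 - σa : ℝ)‖ +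
        ‖(π : ℂ) ^ (-(σb : ℂ)) * Complex.Gamma σb * riemannZeta (2 * σb)‖ * ‖eisensteinE w σb‖ +
        (1 / (1 - σa) + 1 / σb) / 2 := by
  have h1 := norm_Lambda₀_le_re_add_re w ha hb
  have hfe : (thetaFEPair w).Λ₀ σa = (thetaFEPair w).Λ₀ ((1 - σa : ℝ) : ℂ) := by
    rw [← Literature.Barriers.RiemannHypothesis.thetaFEPair_Λ₀_one_sub w σa]
    push_cast; ring_nf
  rw [hfe] at h1
  have h2 := Lambda₀_re_le_of_one_lt w (σ := 1 - σa) (by linarith)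
  have h3 := Lambda₀_re_le_of_one_lt w hσb
  rw [completedEisenstein₀, norm_div, Complex.norm_two, div_le_iff₀ (by norm_num : (0 : ℝ) < 2)]
  have := h1.trans (add_le_add h2 h3)
  linarith

end Majorant

/-! ### `J₀(s) = ∫_𝒟 G · E₀*(·, s)`: holomorphy, functional equation, identification, bounds -/

section J₀

variable {G : ℍ → ℝ} {C : ℕ → ℝ} {a B κ : ℝ}

/-- The weight of the majorant, `G(w) (c₁ ‖E(w, σ₁)‖ + c₂ ‖E(w, σ₂)‖ + c₃)`, is integrable on `𝒟`
(`σ₁, σ₂ > 1`). [folklore] -/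
theorem integrableOn_fd_majorant (hGc : Continuous G)
    (hGinv : ∀ (A : SL(2, ℤ)) (τ : ℍ), G (A • τ) = G τ) (hG0 : ∀ τ, 0 ≤ G τ)
    (hGB : ∀ τ, G τ ≤ B) (hC : ∀ n, 0 ≤ C n) (hC0 : C 0 = 0) (ha : 0 < a) (hκ : 0 ≤ κ)
    (hs : ∀ y : ℝ, 0 < y → Summable fun n : ℕ ↦ C n * Real.exp (-a * n * y))
    (hm : ∀ y : ℝ, 0 < y → ∫ x in (0 : ℝ)..1, G (pt x y) = y ^ κ * ∑' n : ℕ, C n * Real.exp (-a * n * y))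
    {σ₁ σ₂ : ℝ} (hσ₁ : 1 < σ₁) (hσ₂ : 1 < σ₂) (c₁ c₂ c₃ : ℝ) :
    IntegrableOn (fun w : ℍ ↦ G w * (c₁ * ‖eisensteinE w σ₁‖ + c₂ * ‖eisensteinE w σ₂‖ + c₃))
      ModularGroup.fd := by
  haveI : IsFiniteMeasure (volume.restrict ModularGroup.fd) := isFiniteMeasure_restrict_fd
  have h1 := (integrableOn_fd_mul_eisensteinE hGc hGinv hG0 hGB hC hC0 ha hκ hs hm
    (s := σ₁) (by simpa using hσ₁)).norm
  have h2 := (integrableOn_fd_mul_eisensteinE hGc hGinv hG0 hGB hC hC0 ha hκ hs hm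
    (s := σ₂) (by simpa using hσ₂)).norm
  have h3 : IntegrableOn (fun w : ℍ ↦ G w) ModularGroup.fd := by
    refine Integrable.mono' (integrable_const B) hGc.aestronglyMeasurable.restrict (ae_of_all _ fun w ↦ ?_)
    rw [Real.norm_of_nonneg (hG0 w)]; exact hGB w
  have e : (fun w : ℍ ↦ G w * (c₁ * ‖eisensteinE w σ₁‖ + c₂ * ‖eisensteinE w σ₂‖ + c₃)) =
      fun w ↦ c₁ * ‖(G w : ℂ) * eisensteinE w σ₁‖ + c₂ * ‖(G w : ℂ) * eisensteinE w σ₂‖ + c₃ * G w := by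
    funext w
    rw [norm_mul, norm_mul, Complex.norm_real, Real.norm_of_nonneg (hG0 w)]
    ring
  rw [e]
  exact ((h1.const_mul c₁).add (h2.const_mul c₂)).add (h3.const_mul c₃)

/-- **`J₀(s) = ∫_𝒟 G(w) E₀*(w, s) dμ(w)` is entire** for a horocycle datum `G` (Rankin 1939,
Thm. 3; Zagier 1981, §1): on each strip `σ_a < Re s < σ_b` the integrand is dominated by the
integrable weight of `norm_completedEisenstein₀_le`, and `E₀*(w, ·)` is entire. [cite: Rankin1939, §4] -/
theorem differentiable_J₀ (hGc : Continuous G)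
    (hGinv : ∀ (A : SL(2, ℤ)) (τ : ℍ), G (A • τ) = G τ) (hG0 : ∀ τ, 0 ≤ G τ)
    (hGB : ∀ τ, G τ ≤ B) (hC : ∀ n, 0 ≤ C n) (hC0 : C 0 = 0) (ha : 0 < a) (hκ : 0 ≤ κ)
    (hs : ∀ y : ℝ, 0 < y → Summable fun n : ℕ ↦ C n * Real.exp (-a * n * y))
    (hm : ∀ y : ℝ, 0 < y → ∫ x in (0 : ℝ)..1, G (pt x y) = y ^ κ * ∑' n : ℕ, C n * Real.exp (-a * n * y)) :
    Differentiable ℂ fun s : ℂ ↦ ∫ w in ModularGroup.fd, (G w : ℂ) * completedEisenstein₀ w s := by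
  -- differentiability on each open strip `-n < Re s < n + 1`, `n ≥ 1`
  have hstrip : ∀ n : ℕ, 1 ≤ n → DifferentiableOn ℂ
      (fun s : ℂ ↦ ∫ w in ModularGroup.fd, (G w : ℂ) * completedEisenstein₀ w s)
      {s : ℂ | -(n : ℝ) < s.re ∧ s.re < n + 1} := by
    intro n hn
    have hn' : (1 : ℝ) ≤ n := by exact_mod_cast hn
    have hσa : (-(n : ℝ) - 1) < 0 := by linarith
    have hσb : (1 : ℝ) < n + 2 := by linarith
    have hbi : Integrable (fun w : ℍ ↦ G w *
        (‖(π : ℂ) ^ (-((1 - (-(n : ℝ) - 1) : ℝ) : ℂ)) * Complex.Gamma (1 - (-(n : ℝ) - 1) : ℝ) *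
            riemannZeta (2 * (1 - (-(n : ℝ) - 1) : ℝ))‖ * ‖eisensteinE w (1 - (-(n : ℝ) - 1) : ℝ)‖ +
          ‖(π : ℂ) ^ (-((n + 2 : ℝ) : ℂ)) * Complex.Gamma (n + 2 : ℝ) * riemannZeta (2 * (n + 2 : ℝ))‖ *
            ‖eisensteinE w (n + 2 : ℝ)‖ +
          (1 / (1 - (-(n : ℝ) - 1)) + 1 / (n + 2 : ℝ)) / 2)) (volume.restrict ModularGroup.fd) :=
      integrableOn_fd_majorant hGc hGinv hG0 hGB hC hC0 ha hκ hs hm (by linarith) hσb _ _ _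
    refine Literature.Analysis.Complex.differentiableOn_integral_of_dominated (μ := volume.restrict ModularGroup.fd)
      (F := fun s w ↦ (G w : ℂ) * completedEisenstein₀ w s) (fun s _ ↦ ?_) (ae_of_all _ fun w ↦ ?_)
      (fun x₀ hx₀ ↦ ?_)
    · -- measurability in `w`
      have h1 : AEStronglyMeasurable (fun w : ℍ ↦ completedEisenstein₀ w s) (volume.restrict ModularGroup.fd) := by
        have := ((locallyIntegrable_Lambda₀ s).aestronglyMeasurable).restrict (s := ModularGroup.fd)
        refine (this.const_mul (1 / 2 : ℂ)).congr (ae_of_all _ fun w ↦ ?_)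
        simp only [completedEisenstein₀]; ring
      exact ((Complex.continuous_ofReal.comp hGc).aestronglyMeasurable.restrict).mul h1
    · -- holomorphy in `s`
      exact ((differentiable_completedEisenstein₀ w).const_mul _).differentiableOn
    · -- local domination
      obtain ⟨hx1, hx2⟩ := hx₀
      set R : ℝ := min (x₀.re + n) (n + 1 - x₀.re) with hR
      have hR0 : 0 < R := lt_min (by linarith) (by linarith)
      refine ⟨R, hR0, fun s hs' ↦ ?_, _, hbi, ae_of_all _ fun w s hs' ↦ ?_⟩
      · have h := Metric.mem_ball.mp hs'
        rw [dist_eq_norm] at h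
        have hre : |(s - x₀).re| < R := (Complex.abs_re_le_norm _).trans_lt h
        rw [Complex.sub_re, abs_lt] at hre
        constructor
        · have := min_le_left (x₀.re + n) (n + 1 - x₀.re); linarith [hre.1]
        · have := min_le_right (x₀.re + n) (n + 1 - x₀.re); linarith [hre.2]
      · have h := Metric.mem_ball.mp hs'
        rw [dist_eq_norm] at h
        have hre : |(s - x₀).re| < R := (Complex.abs_re_le_norm _).trans_lt h
        rw [Complex.sub_re, abs_lt] at hre
        have hsa : (-(n : ℝ) - 1) ≤ s.re := by
          have := min_le_left (x₀.re + n) (n + 1 - x₀.re); linarith [hre.1]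
        have hsb : s.re ≤ (n : ℝ) + 2 := by
          have := min_le_right (x₀.re + n) (n + 1 - x₀.re); linarith [hre.2]
        have hE := norm_completedEisenstein₀_le w hσa hσb hsa hsb
        rw [norm_mul, Complex.norm_real, Real.norm_of_nonneg (hG0 w)]
        exact mul_le_mul_of_nonneg_left hE (hG0 w)
  intro s
  obtain ⟨n, hn⟩ : ∃ n : ℕ, |s.re| < n := exists_nat_gt _
  have hn1 : 1 ≤ n + 1 := Nat.le_add_left 1 n
  have hmem : s ∈ {s : ℂ | -((n + 1 : ℕ) : ℝ) < s.re ∧ s.re < (n + 1 : ℕ) + 1} := by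
    constructor <;> push_cast <;> linarith [abs_lt.mp hn |>.1, abs_lt.mp hn |>.2]
  have hopen : IsOpen {s : ℂ | -((n + 1 : ℕ) : ℝ) < s.re ∧ s.re < (n + 1 : ℕ) + 1} :=
    (isOpen_lt continuous_const Complex.continuous_re).inter (isOpen_lt Complex.continuous_re continuous_const)
  exact (hstrip (n + 1) hn1).differentiableAt (hopen.mem_nhds hmem)

/-- `E₀*(w, 1 - s) = E₀*(w, s)`. [folklore] -/
theorem completedEisenstein₀_one_sub (w : ℍ) (s : ℂ) :
    completedEisenstein₀ w (1 - s) = completedEisenstein₀ w s := by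
  rw [completedEisenstein₀, completedEisenstein₀, Literature.Barriers.RiemannHypothesis.thetaFEPair_Λ₀_one_sub]

/-- **The functional equation `J₀(1 - s) = J₀(s)`** (Rankin 1939, Thm. 3 (4.4.6); Zagier 1981, §1,
Proposition). [cite: Rankin1939, §4] -/
theorem J₀_one_sub (G : ℍ → ℝ) (s : ℂ) :
    ∫ w in ModularGroup.fd, (G w : ℂ) * completedEisenstein₀ w (1 - s) =
      ∫ w in ModularGroup.fd, (G w : ℂ) * completedEisenstein₀ w s := by
  simp_rw [completedEisenstein₀_one_sub]

/-- **`J₀` on the half-plane of convergence** (Rankin 1939, (4.4.2)–(4.4.5)): for `Re s > 1`,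
`J₀(s) = π^{-s} Γ(s) ζ(2s) · Γ(s+κ-1) a^{-(s+κ-1)} D(s+κ-1) + (1/(2s) + 1/(2(1-s))) V`,
`V = ∫_𝒟 G dμ`. [cite: Rankin1939, §4] -/
theorem J₀_eq_of_one_lt_re (hGc : Continuous G)
    (hGinv : ∀ (A : SL(2, ℤ)) (τ : ℍ), G (A • τ) = G τ) (hG0 : ∀ τ, 0 ≤ G τ)
    (hGB : ∀ τ, G τ ≤ B) (hC : ∀ n, 0 ≤ C n) (hC0 : C 0 = 0) (ha : 0 < a) (hκ : 0 ≤ κ)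
    (hs : ∀ y : ℝ, 0 < y → Summable fun n : ℕ ↦ C n * Real.exp (-a * n * y))
    (hle : ∀ y : ℝ, 0 < y → ∑' n : ℕ, C n * Real.exp (-a * n * y) ≤ B * y ^ (-κ))
    (hm : ∀ y : ℝ, 0 < y → ∫ x in (0 : ℝ)..1, G (pt x y) = y ^ κ * ∑' n : ℕ, C n * Real.exp (-a * n * y))
    {s : ℂ} (hs1 : 1 < s.re) :
    ∫ w in ModularGroup.fd, (G w : ℂ) * completedEisenstein₀ w s =
      (π : ℂ) ^ (-s) * Complex.Gamma s * riemannZeta (2 * s) *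
          (Complex.Gamma (s + κ - 1) * (a : ℂ) ^ (-(s + κ - 1)) * LSeries (fun n ↦ (C n : ℂ)) (s + κ - 1)) +
        (1 / (2 * s) + 1 / (2 * (1 - s))) * ∫ w in ModularGroup.fd, (G w : ℂ) := by
  haveI : IsFiniteMeasure (volume.restrict ModularGroup.fd) := isFiniteMeasure_restrict_fd
  have hint := integrableOn_fd_mul_eisensteinE hGc hGinv hG0 hGB hC hC0 ha hκ hs hm hs1
  have hGi : IntegrableOn (fun w : ℍ ↦ (G w : ℂ)) ModularGroup.fd := by
    refine Integrable.mono' (integrable_const B) (Complex.continuous_ofReal.comp hGc).aestronglyMeasurable.restrict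
      (ae_of_all _ fun w ↦ ?_)
    rw [Complex.norm_real, Real.norm_of_nonneg (hG0 w)]; exact hGB w
  set L : ℂ := (π : ℂ) ^ (-s) * Complex.Gamma s * riemannZeta (2 * s) with hL
  have hpt : ∀ w : ℍ, (G w : ℂ) * completedEisenstein₀ w s =
      L * ((G w : ℂ) * eisensteinE w s) + (1 / (2 * s) + 1 / (2 * (1 - s))) * (G w : ℂ) := by
    intro w
    have h1 : completedEisenstein₀ w s = completedEisenstein w s + 1 / (2 * s) + 1 / (2 * (1 - s)) := by
      rw [completedEisenstein_eq]; ring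
    rw [h1, completedEisenstein_eq_theta_mul w hs1, hL]; ring
  simp_rw [hpt]
  rw [integral_add (hint.const_mul L) (hGi.const_mul _), integral_const_mul, integral_const_mul,
    setIntegral_fd_mul_eisensteinE_eq hGc hGinv hG0 hGB hC hC0 ha hκ hs hle hm hs1]

/-- **The a priori bound on vertical strips**: for `σ_a < 0`, `σ_b > 1` and
`σ_a ≤ Re s ≤ σ_b`, `‖J₀(s)‖ ≤ M(σ_a, σ_b)`, independent of `Im s` (the integral of the majorant
weight). [folklore] -/
theorem norm_J₀_le (hGc : Continuous G)
    (hGinv : ∀ (A : SL(2, ℤ)) (τ : ℍ), G (A • τ) = G τ) (hG0 : ∀ τ, 0 ≤ G τ)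
    (hGB : ∀ τ, G τ ≤ B) (hC : ∀ n, 0 ≤ C n) (hC0 : C 0 = 0) (ha : 0 < a) (hκ : 0 ≤ κ)
    (hs : ∀ y : ℝ, 0 < y → Summable fun n : ℕ ↦ C n * Real.exp (-a * n * y))
    (hm : ∀ y : ℝ, 0 < y → ∫ x in (0 : ℝ)..1, G (pt x y) = y ^ κ * ∑' n : ℕ, C n * Real.exp (-a * n * y))
    {σa σb : ℝ} (hσa : σa < 0) (hσb : 1 < σb) :
    ∃ M : ℝ, ∀ s : ℂ, σa ≤ s.re → s.re ≤ σb →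
      ‖∫ w in ModularGroup.fd, (G w : ℂ) * completedEisenstein₀ w s‖ ≤ M := by
  set c₁ : ℝ := ‖(π : ℂ) ^ (-((1 - σa : ℝ) : ℂ)) * Complex.Gamma (1 - σa : ℝ) * riemannZeta (2 * (1 - σa : ℝ))‖
  set c₂ : ℝ := ‖(π : ℂ) ^ (-(σb : ℂ)) * Complex.Gamma σb * riemannZeta (2 * σb)‖
  set c₃ : ℝ := (1 / (1 - σa) + 1 / σb) / 2
  set bound : ℍ → ℝ := fun w ↦ G w * (c₁ * ‖eisensteinE w (1 - σa : ℝ)‖ + c₂ * ‖eisensteinE w σb‖ + c₃)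
  have hbi : Integrable bound (volume.restrict ModularGroup.fd) :=
    integrableOn_fd_majorant hGc hGinv hG0 hGB hC hC0 ha hκ hs hm (by linarith) hσb c₁ c₂ c₃
  refine ⟨∫ w in ModularGroup.fd, bound w, fun s hsa hsb ↦ ?_⟩
  refine (norm_integral_le_integral_norm _).trans (integral_mono_of_nonneg (ae_of_all _ fun w ↦ norm_nonneg _)
    hbi (ae_of_all _ fun w ↦ ?_))
  have hE := norm_completedEisenstein₀_le w hσa hσb hsa hsb
  dsimp only
  rw [norm_mul, Complex.norm_real, Real.norm_of_nonneg (hG0 w)]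
  calc G w * ‖completedEisenstein₀ w s‖ ≤ G w * (c₁ * ‖eisensteinE w (1 - σa : ℝ)‖ + c₂ * ‖eisensteinE w σb‖ + c₃) :=
        mul_le_mul_of_nonneg_left hE (hG0 w)
    _ = bound w := rfl

end J₀

end Literature.NumberTheory.Automorphic

end
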